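import Mathlib.Topology.Maps.Proper.CompactlyGenerated
import Mathlib.Topology.Metrizable.Basic
import Mathlib.Analysis.Normed.Group.Bounded
import Mathlib.Analysis.Complex.ReImTopology
import Literature.Probability.RandomPlanarGeometry.CritPercSLE
import HarnessLib

/-!
# The space-filling phase `κ ≥ 8` of chordal SLE: reduction to the Rohde–Schramm inputs

This file reduces the named fact `Literature.Probability.RandomPlanarGeometry.ae_isSpaceFilling_sleTrace_of_eight_le` of
`Literature.Probability.RandomPlanarGeometry.CritPercSLE` (**crit-perc.S20**, space-filling
phase: for `κ ≥ 8` the chordal SLE_κ trace `γ` satisfies `γ[0, ∞) = closure ℍ` almost surely) to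
the results it is printed from, following the proof in the source *verbatim*.

**Source and locator.** S. Rohde, O. Schramm, *Basic properties of SLE*, Ann. of Math. 161
(2005) 883–924. The printed statement is **Corollary 7.4** (p. 911): "Suppose that `κ > 8`, then
`γ[0, ∞) = H̄` a.s.", followed by "**Update.** Corollary 7.4 and Theorem 7.1 are true also for
`κ = 8`. The proofs are based on the extension [LSW] to `κ = 8` of Theorem 5.1, and are otherwise
the same." (The docstring of the target fact says "Thm 7.9"; the paper has no Theorem 7.9 — the
result is Cor. 7.4 with its Update. The *statement* vendored in `CritPercSLE` is faithful.)

**Printed proof** (p. 911): "From Lemma 6.3 and (6.2) we know that `γ[0, ∞)` is a.s. dense in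
`H̄`. Since `γ` is a.s. transient, `γ[0, ∞)` is closed in `ℂ`, and hence is equal to `H̄`." Its
three inputs are

1. **density** — Lemma 6.3 (p. 903): for `z₀ ∈ ℍ` the limit
   `Z(z₀) = lim_{t ↑ τ(z₀)} (Im z₀) |gₜ'(z₀)| / Im gₜ(z₀)` exists a.s., and `Z(z₀) = ∞` a.s. if
   `κ ≥ 8`; together with eq. (6.2) (Schwarz lemma and Koebe 1/4 theorem),
   `Z(z₀)⁻¹ Im z₀ / 2 ≤ dist(z₀, γ[0, ∞) ∪ ℝ) ≤ 2 Z(z₀)⁻¹ Im z₀`, whence (p. 904) "`γ[0, ∞)` is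
   dense in `H̄` if and only if `κ ≥ 8`". Vendored here as the named fact
   `Literature.Probability.RandomPlanarGeometry.ae_infDist_sleTrace_eq_zero_of_eight_le` in its per-point form (the form Lemma 6.3 has:
   `z₀` fixed, then a.s.), and upgraded to almost sure density by a countable dense set of
   points (`Literature.Probability.RandomPlanarGeometry.ae_subset_closure_range_sleTrace`, proved);
2. **transience** — Theorem 7.1 (+ Update): the existing named fact
   `Literature.Probability.RandomPlanarGeometry.tendsto_norm_sleTrace_atTop` of `SLE.lean`;
3. **the trace exists** — Theorem 5.1 (`κ ≠ 8`) and Lawler–Schramm–Werner (2004), Thm 4.7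
   (`κ = 8`): the existing named facts `Literature.Probability.RandomPlanarGeometry.hasSLETrace_of_ne_eight`, `Literature.Probability.RandomPlanarGeometry.hasSLETrace_eight`.

The deterministic topology ("transient ⇒ closed range", "closed and dense in `H̄`, contained in
`H̄` ⇒ equal to `H̄`") is proved (`Literature.Probability.RandomPlanarGeometry.Loewner.isClosed_range_of_tendsto_norm_atTop`,
`Literature.Probability.RandomPlanarGeometry.Loewner.isSpaceFilling_of_subset_closure`), and the assembly is
`Literature.Probability.RandomPlanarGeometry.ae_isSpaceFilling_sleTrace_of_eight_le_of_facts`; the case `κ > 8` (Cor. 7.4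
proper, no input from [LSW]) is `Literature.Probability.RandomPlanarGeometry.ae_isSpaceFilling_sleTrace_of_eight_lt`.

## Mathlib

We USE `isProperMap_iff_tendsto_cocompact` / `IsProperMap.isClosed_range` (a continuous map
tending to infinity at infinity has closed range), `cocompact_eq_atTop` (on `ℝ≥0`),
`Metric.cobounded_eq_cocompact`, `tendsto_norm_atTop_iff_cobounded`,
`TopologicalSpace.IsSeparable.exists_countable_dense_subset`, `MeasureTheory.ae_ball_iff`,
`Metric.mem_closure_iff_infDist_zero`, `Complex.closure_setOf_lt_im`. Mathlib has no SLE.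

## References

* S. Rohde, O. Schramm, *Basic properties of SLE*, Ann. of Math. 161 (2005) 883–924:
  Lemma 6.3 and eq. (6.2) (pp. 903–904), Theorem 7.1 (p. 909), Corollary 7.4 and the Update
  following it (p. 911).
* G. F. Lawler, O. Schramm, W. Werner, *Conformal invariance of planar loop-erased random walks
  and uniform spanning trees*, Ann. Probab. 32 (2004) 939–995, Thm 4.7 (SLE₈ is a curve).
-/

noncomputable section

open Set Filter Topology MeasureTheory Metric Bornology
open UpperHalfPlane (upperHalfPlaneSet isOpen_upperHalfPlaneSet)
open scoped NNReal

namespace Literature.Probability.RandomPlanarGeometry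

/-! ### Named fact: for `κ ≥ 8` the trace comes arbitrarily close to every point -/

/-- **The SLE_κ trace is dense for `κ ≥ 8`, per-point form** (Rohde–Schramm, Ann. Math. 161
(2005), Lemma 6.3 with eq. (6.2), pp. 903–904). For `z₀ ∈ ℍ` let `τ(z₀)` be its swallowing time
and `Z(z₀) := lim_{t ↑ τ(z₀)} (Im z₀) |gₜ'(z₀)| / Im gₜ(z₀)`. Lemma 6.3: for `κ > 0` and
`z₀ ∈ ℍ` the limit exists a.s., and `Z(z₀) = ∞` a.s. if `κ ≥ 8` (`Z(z₀) < ∞` a.s. if `κ < 8`).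
Eq. (6.2) (Schwarz lemma and Koebe 1/4 theorem applied to `gₜ` near `z₀`):
`Z(z₀)⁻¹ Im z₀ / 2 ≤ dist(z₀, γ[0, ∞) ∪ ℝ) ≤ 2 Z(z₀)⁻¹ Im z₀`. Hence, for `κ ≥ 8` and every
fixed `z₀ ∈ ℍ`, almost surely `dist(z₀, γ[0, ∞) ∪ ℝ) = 0` ("In particular, the lemma tells us
that `γ[0, ∞)` is dense in `H̄` if and only if `κ ≥ 8`", p. 904). Here `γ = sleTrace κ ω` is the
SLE_κ trace (for `κ = 8` it exists by Lawler–Schramm–Werner (2004), Thm 4.7, and the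
parenthetical definition of `γ[0, ∞)` on p. 904 agrees with it). Stated for the open half-plane
`ℍ = upperHalfPlaneSet` and Mathlib's `Metric.infDist`.
[cite: RohdeSchramm2005, Lemma 6.3 and eq. (6.2)] -/
def ae_infDist_sleTrace_eq_zero_of_eight_le : Prop :=
  ∀ {κ : ℝ≥0}, 8 ≤ κ → ∀ z ∈ upperHalfPlaneSet,
    ∀ᵐ ω ∂Process.preWienerMeasure, infDist z (range (sleTrace κ ω) ∪ {w : ℂ | w.im = 0}) = 0

/-! ### Deterministic topology of curves in the closed half-plane -/

namespace Loewner

/-- **A transient continuous curve has closed range**: if `γ : [0, ∞) → ℂ` is continuous and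
`|γ(t)| → ∞` as `t → ∞`, then `γ[0, ∞)` is closed in `ℂ` (`γ` is then a proper map). This is the
step "since `γ` is a.s. transient, `γ[0, ∞)` is closed in `ℂ`" of Rohde–Schramm (2005), proof of
Cor. 7.4, p. 911. [folklore] -/
theorem isClosed_range_of_tendsto_norm_atTop {γ : ℝ≥0 → ℂ} (hγ : Continuous γ)
    (h : Tendsto (fun t ↦ ‖γ t‖) atTop atTop) : IsClosed (range γ) := by
  have h' : Tendsto γ (cocompact ℝ≥0) (cocompact ℂ) := by
    rw [cocompact_eq_atTop, ← Metric.cobounded_eq_cocompact]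
    exact tendsto_norm_atTop_iff_cobounded.1 h
  exact (isProperMap_iff_tendsto_cocompact.2 ⟨hγ, h'⟩).isClosed_range

/-- The range of a curve with nonnegative imaginary part lies in the closed upper half-plane
`closure ℍ = {z | 0 ≤ im z}`. [folklore] -/
theorem range_subset_closure_upperHalfPlaneSet {γ : ℝ≥0 → ℂ} (him : ∀ t, 0 ≤ (γ t).im) :
    range γ ⊆ closure upperHalfPlaneSet := by
  rw [show closure upperHalfPlaneSet = {z : ℂ | 0 ≤ z.im} from Complex.closure_setOf_lt_im 0]
  rintro _ ⟨t, rfl⟩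
  exact him t

/-- A point of the open upper half-plane at distance `0` from `A ∪ ℝ` lies in the closure of `A`
(its distance to `ℝ` is `Im z > 0`). The passage from eq. (6.2) of Rohde–Schramm (2005) to
density of the trace. [folklore] -/
theorem mem_closure_of_infDist_union_eq_zero {A : Set ℂ} {z : ℂ} (hz : z ∈ upperHalfPlaneSet)
    (hA : A.Nonempty) (h : infDist z (A ∪ {w : ℂ | w.im = 0}) = 0) : z ∈ closure A := by
  have hcl : IsClosed {w : ℂ | w.im = 0} := isClosed_eq Complex.continuous_im continuous_const
  have hmem : z ∈ closure (A ∪ {w : ℂ | w.im = 0}) :=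
    (mem_closure_iff_infDist_zero (hA.mono subset_union_left)).2 h
  rw [closure_union, hcl.closure_eq] at hmem
  rcases hmem with hmem | hmem
  · exact hmem
  · exact absurd hmem (ne_of_gt hz)

/-- **Deterministic criterion for the space-filling phase** (the topology in the proof of
Rohde–Schramm (2005), Cor. 7.4, p. 911): a continuous curve `γ : [0, ∞) → closure ℍ` which is
transient (`|γ(t)| → ∞`) and whose range is dense in `ℍ` (`ℍ ⊆ closure γ[0, ∞)`) is
space-filling, `γ[0, ∞) = closure ℍ` — the range is closed, contains the closure of `ℍ`, and is
contained in it. [cite: RohdeSchramm2005, proof of Cor. 7.4] -/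
theorem isSpaceFilling_of_subset_closure {γ : ℝ≥0 → ℂ} (hγ : Continuous γ)
    (him : ∀ t, 0 ≤ (γ t).im) (ht : Tendsto (fun t ↦ ‖γ t‖) atTop atTop)
    (hd : upperHalfPlaneSet ⊆ closure (range γ)) : IsSpaceFilling γ := by
  have hcl : IsClosed (range γ) := isClosed_range_of_tendsto_norm_atTop hγ ht
  refine Subset.antisymm (range_subset_closure_upperHalfPlaneSet him) ?_
  calc closure upperHalfPlaneSet ⊆ closure (closure (range γ)) := closure_mono hd
    _ = range γ := by rw [closure_closure, hcl.closure_eq]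

/-- Conversely, a space-filling curve has range dense in (indeed containing) `ℍ`. [folklore] -/
theorem IsSpaceFilling.subset_closure_range {γ : ℝ≥0 → ℂ} (h : IsSpaceFilling γ) :
    upperHalfPlaneSet ⊆ closure (range γ) := by
  rw [IsSpaceFilling] at h
  rw [h, closure_closure]
  exact subset_closure

end Loewner

/-! ### From per-point density to almost sure density -/

/-- **Almost sure density of the SLE_κ trace for `κ ≥ 8`** from the per-point fact
`ae_infDist_sleTrace_eq_zero_of_eight_le` (hypothesis `hd`): almost surely
`ℍ ⊆ closure γ[0, ∞)`. Proof: pick a countable set `D ⊆ ℍ` dense in `ℍ`; almost surely every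
point of `D` is at distance `0` from `γ[0, ∞) ∪ ℝ`, hence in `closure γ[0, ∞)`, and then so is
every point of `ℍ ⊆ closure D`. This is the sentence "from Lemma 6.3 and (6.2) we know that
`γ[0, ∞)` is a.s. dense in `H̄`" of Rohde–Schramm (2005), proof of Cor. 7.4, p. 911.
[cite: RohdeSchramm2005, proof of Cor. 7.4] -/
theorem ae_subset_closure_range_sleTrace (hd : ae_infDist_sleTrace_eq_zero_of_eight_le)
    {κ : ℝ≥0} (hκ : 8 ≤ κ) :
    ∀ᵐ ω ∂Process.preWienerMeasure, upperHalfPlaneSet ⊆ closure (range (sleTrace κ ω)) := by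
  obtain ⟨D, hDsub, hDc, hDd⟩ :=
    (TopologicalSpace.IsSeparable.of_separableSpace upperHalfPlaneSet).exists_countable_dense_subset
  have hD : ∀ᵐ ω ∂Process.preWienerMeasure, ∀ z ∈ D,
      infDist z (range (sleTrace κ ω) ∪ {w : ℂ | w.im = 0}) = 0 :=
    (ae_ball_iff hDc).2 fun z hz ↦ hd hκ z (hDsub hz)
  filter_upwards [hD] with ω hω
  have hDcl : D ⊆ closure (range (sleTrace κ ω)) := fun z hz ↦
    Loewner.mem_closure_of_infDist_union_eq_zero (hDsub hz) (range_nonempty _) (hω z hz)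
  exact hDd.trans (closure_minimal hDcl isClosed_closure)

/-! ### Assembly: the space-filling phase from the Rohde–Schramm inputs -/

/-- **Space-filling from trace existence, transience and density** (the proof of Rohde–Schramm
(2005), Cor. 7.4, p. 911, for one value of `κ`): if almost surely the SLE_κ chain is generated by
a curve (`HasSLETrace κ`), the trace is transient and its range is dense in `ℍ`, then almost
surely the trace is space-filling. [cite: RohdeSchramm2005, proof of Cor. 7.4] -/
theorem ae_isSpaceFilling_sleTrace_of_hasSLETrace {κ : ℝ≥0} (hγ : HasSLETrace κ)
    (htr : ∀ᵐ ω ∂Process.preWienerMeasure, Tendsto (fun t ↦ ‖sleTrace κ ω t‖) atTop atTop)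
    (hd : ∀ᵐ ω ∂Process.preWienerMeasure, upperHalfPlaneSet ⊆ closure (range (sleTrace κ ω))) :
    ∀ᵐ ω ∂Process.preWienerMeasure, Loewner.IsSpaceFilling (sleTrace κ ω) := by
  filter_upwards [ae_isGeneratedByCurve_sleTrace hγ, htr, hd] with ω hg ht hdω
  exact Loewner.isSpaceFilling_of_subset_closure hg.continuous hg.im_nonneg ht hdω

section CritPerc

/-- **Rohde–Schramm, Cor. 7.4, as printed (`κ > 8`)**: for `κ > 8` the SLE_κ trace is almost
surely space-filling, `γ[0, ∞) = closure ℍ` — from the Rohde–Schramm theorem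
(`hasSLETrace_of_ne_eight`, Thm 5.1; hypothesis `hne`), transience
(`tendsto_norm_sleTrace_atTop`, Thm 7.1; `htr`) and per-point density
(`ae_infDist_sleTrace_eq_zero_of_eight_le`, Lemma 6.3 with eq. (6.2); `hd`). No input from
Lawler–Schramm–Werner (2004) is needed in this range. [cite: RohdeSchramm2005, Cor. 7.4] -/
theorem ae_isSpaceFilling_sleTrace_of_eight_lt (hne : hasSLETrace_of_ne_eight)
    (htr : tendsto_norm_sleTrace_atTop) (hd : ae_infDist_sleTrace_eq_zero_of_eight_le)
    {κ : ℝ≥0} (hκ : 8 < κ) :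
    ∀ᵐ ω ∂Process.preWienerMeasure, Loewner.IsSpaceFilling (sleTrace κ ω) :=
  ae_isSpaceFilling_sleTrace_of_hasSLETrace (hne hκ.ne') (htr ((by norm_num : (0 : ℝ≥0) < 8).trans hκ))
    (ae_subset_closure_range_sleTrace hd hκ.le)

/-- **crit-perc.S20, space-filling phase, from the Rohde–Schramm inputs** (Rohde–Schramm, Ann.
Math. 161 (2005), Cor. 7.4 and the Update following it, p. 911): the named fact
`ae_isSpaceFilling_sleTrace_of_eight_le` (for `κ ≥ 8` the SLE_κ trace is a.s. space-filling)
follows from: SLE₈ is generated by a curve (`hasSLETrace_eight`, Lawler–Schramm–Werner (2004),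
Thm 4.7; hypothesis `h8`), SLE_κ is generated by a curve for `κ ≠ 8` (`hasSLETrace_of_ne_eight`,
RS05 Thm 5.1; `hne`), transience of the trace (`tendsto_norm_sleTrace_atTop`, RS05 Thm 7.1 and
its Update; `htr`) and the per-point density of the trace for `κ ≥ 8`
(`ae_infDist_sleTrace_eq_zero_of_eight_le`, RS05 Lemma 6.3 with eq. (6.2); `hd`) — exactly the
printed proof: dense (Lemma 6.3, (6.2)) and closed (transience) in `H̄`.
[cite: RohdeSchramm2005, Cor. 7.4 and Update (p. 911)] -/
theorem ae_isSpaceFilling_sleTrace_of_eight_le_of_facts (h8 : hasSLETrace_eight)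
    (hne : hasSLETrace_of_ne_eight) (htr : tendsto_norm_sleTrace_atTop)
    (hd : ae_infDist_sleTrace_eq_zero_of_eight_le) {κ : ℝ≥0} :
    ae_isSpaceFilling_sleTrace_of_eight_le (κ := κ) := fun hκ ↦
  ae_isSpaceFilling_sleTrace_of_hasSLETrace (hasSLETrace h8 hne κ)
    (htr ((by norm_num : (0 : ℝ≥0) < 8).trans_le hκ)) (ae_subset_closure_range_sleTrace hd hκ)

/-- **Consistency of the decomposition**: the per-point density fact
`ae_infDist_sleTrace_eq_zero_of_eight_le` is itself a consequence of the space-filling phase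
(for `κ ≥ 8` and `z ∈ ℍ ⊆ closure ℍ = γ[0, ∞)`, the distance from `z` to `γ[0, ∞)` is `0`
surely on the full-measure event), so the new named fact does not claim more than
Rohde–Schramm's Cor. 7.4 with its Update. [folklore] -/
theorem ae_infDist_sleTrace_eq_zero_of_isSpaceFilling
    (h : ∀ κ : ℝ≥0, ae_isSpaceFilling_sleTrace_of_eight_le (κ := κ)) :
    ae_infDist_sleTrace_eq_zero_of_eight_le := by
  intro κ hκ z hz
  filter_upwards [h κ hκ] with ω hω
  refine infDist_zero_of_mem (Or.inl ?_)
  rw [show range (sleTrace κ ω) = closure upperHalfPlaneSet from hω]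
  exact subset_closure hz

end CritPerc

end Literature.Probability.RandomPlanarGeometry

end
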